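/-
Copyright (c) 2026 the pub-hodgecm-mathlib formalisation cell (harness21).  Prover seat hodgecm-mathlib-F0P3-p03 (g15): road «S3-ram» (LEAD F0P3a-plan (g12); owner
F0P3a-p06 (g15)); (α₂) A₂ (d) «type-(2) G-side» (F0P3a-p07 (g13∕g14)), organ (d-iv-col) «COLLAR LABEL LAW», LATTICE half (welcomed 2026-09-02T00:48:31Z); 2026-09-02.
-/
import Literature.NumberTheory.Automorphic.UnitaryLatticeTreeIsolatedRootChildClassRamified   -- ★ p847311∕p847396 (this seat): the class lock at a split vertex, block additivity (parent side)
import HarnessLib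

/-!
# The lattice graph of a hermitian space — THE VALUE LAW ON A GLUED CHILD, GENERATOR CURRENCY: for `y = b + t·ϖ⁻¹x` with `b, x` in a lattice `M` on which `γ − 1` has
# level `ϖ^d`, the depth-`(d−2)` value `ϖ^{−(d−2)}⟨y, (γ−1)y⟩` is `−σ(t)t·ϖ^{−d}⟨x, (γ−1)x⟩` up to `𝔪` — the child's class is the class of MINUS the parent's value at the
# line, whatever the gluing digit (Bruhat–Tits 1972 §10; Kottwitz 1986 §3; Rogawski 1990 §4.9)

Topic `NumberTheory/Automorphic`; namespace `Literature.NumberTheory.Automorphic.UnitaryLatticeTree`.  THEOREMS ONLY (no definition, no instance, no notation, no named fact,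
no `sorry`); kernel lane `--supports stmt-HodgeConjecture-24833`; datum-free and MODEL-FREE (`K` with `Valued K ℤᵐ⁰`, ANY matrix `H`, any `σ` with `σϖ = −ϖ` and (§2) `σ`
valuation-preserving ∕ residually trivial).  Cell `pub/hodgecm-mathlib` (D-0151), crux H413; road «S3-ram» (Literature seeding, count-neutral).  The LATTICE half of F0P3a-p07's
(d-iv-col) «COLLAR LABEL LAW» (memo `DESIGN-A2d-TypeTwoGSide` v1.2 §3; ORGAN-CARD-Cnt2), in the GLUING currency of ★ p847353 `UnitaryLatticeTreeBlockGluing`: an off-axis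
self-dual grandchild of an axis vertex `M` through the residual line `x̄` (`x ∈ M`) is `N = B₁ ⊔ 𝒪x₀` with glued generator `x₀ = ϖ⁻¹x` (up to the gluing digit) and W-part
`B₁ ≤ M`.  ★ FILE F (`UnitaryLatticeTreeFixedChildClassRamified`, F0P2-p01) proves «class of the child = class of `−Q_Ȳ(x̄)`» in the antidiagonal model through the child FRAME
`κ·g(a,b)`; THIS FILE is the same law WITHOUT frames or a model: every `y = b + t·ϖ⁻¹x` with `b ∈ M` has
  **`|ϖ^{−(d−2)}⟨y, Yy⟩ + σ(t)t·ϖ^{−d}⟨x, Yx⟩| ≤ |ϖ|`**   (`Y = γ − 1` of level `ϖ^d` on `M`, `M ≤ M^♯`, `t` integral; §1 `v_pairing_glued_mulVec_add_le`),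
because `⟨b, Yb⟩ ∈ ϖ^d𝒪`, the cross terms lie in `ϖ^{d−1}𝒪`, and `⟨ϖ⁻¹x, Yϖ⁻¹x⟩ = σ(ϖ)⁻¹ϖ⁻¹⟨x, Yx⟩ = −ϖ^{−2}⟨x, Yx⟩`.  Hence (§2, `σ` residually trivial so `σ(t)t ≡ t²`): the
depth-`(d−2)` form of the child is RANK ONE in the gluing coordinate `t` with coefficient `−ϖ^{−d}⟨x, Yx⟩` — the child's square class is that of MINUS the parent value at the line,
for EVERY gluing digit (`v_pairing_glued_mulVec_add_sq_mul_lt`); with a unit `t` the class is realised (`…_sub_mul_sq_lt_of_unit`, CLS shape) and the other class is not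
(`not_…_other_class`, via ★ `not_v_sub_mul_sq_lt_and_v_sub_mul_mul_sq_lt`); with `|t| < 1` the value vanishes residually.  Composed with ★ G7 (`v_pairing_mulVec_sub_mul_sq_lt_of_block`:
at a split vertex `−ϖ^{−d}⟨x, Yx⟩ ≡ (c − cᵢ)H_ii·x_i²`) this is the COLLAR CLASS LOCK: every off-axis grandchild of an interior axis vertex has the ONE class `(c − cᵢ)H_ii` (§3
`v_pairing_glued_mulVec_sub_mul_sq_lt_of_block`), and with ★ ED. 2 §7 (block additivity, `Ȳ = Ȳ_B ⊕ 0`) the type-(2) collar class is the class of the BINARY value `−Q_{Ȳ_B}(x̄′)`.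
HONEST LABEL: HC_CM is proved only modulo the 2 remaining named inputs (hLiu418 24832, h413 24833) until rung 0 closes; nothing printed is asserted here (elementary lattice algebra
over a valuation ring); «S3-ram» has no books consequence.

* §1 `pairing_glued_eq` (the four-term expansion), `pairing_smul_inv_self` (`⟨ϖ⁻¹x, Yϖ⁻¹x⟩ = −ϖ^{−2}⟨x,Yx⟩` for `σϖ = −ϖ`), **`v_pairing_glued_mulVec_add_le`** (the value law, `≤ |ϖ|`).
* §2 **`v_pairing_glued_mulVec_add_sq_mul_lt`** (`σ(t)t ↦ t²`), `v_pairing_glued_mulVec_sub_mul_sq_lt_of_unit` (CLS shape at a unit digit), `v_pairing_glued_mulVec_lt_one_of_lt`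
  (`|t| < 1`: the value is in `𝔪`), `not_v_pairing_glued_mulVec_sub_mul_mul_sq_lt` (the other class is excluded on the whole child).
* §3 **`v_pairing_glued_mulVec_sub_mul_sq_lt_of_block`** (∘ ★ G7: the collar class lock at a split vertex).

## References
* [BruhatTits1972] F. Bruhat, J. Tits, *Groupes réductifs sur un corps local I*, Publ. Math. IHÉS 41 (1972), §10 (lattice models; neighbours through a residual line).
* [Kottwitz1986] R. E. Kottwitz, *Base change for unit elements of Hecke algebras*, Compositio Math. 60 (1986), §3 (levels of fixed lattices along the tree).
* [Rogawski1990] J. D. Rogawski, *Automorphic Representations of Unitary Groups in Three Variables*, Ann. of Math. Stud. 123 (1990), §4.9 pp. 54–56 (strata by the residual form).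
-/

set_option autoImplicit false

noncomputable section

open scoped Valued WithZero Matrix MatrixGroups

namespace Literature.NumberTheory.Automorphic.UnitaryLatticeTree

open Literature.NumberTheory.Automorphic Literature.NumberTheory.Automorphic.HermitianLattice

variable {K : Type*} [Field K] [Valued K ℤᵐ⁰] {N : ℕ}

/-! ## §1 The value on a glued vector `y = b + t·ϖ⁻¹x` -/

omit [Valued K ℤᵐ⁰] in
/-- The four-term expansion of `⟨b + t·x₀, Y(b + t·x₀)⟩` (`⟨·,·⟩` `σ`-semilinear in the first slot, linear in the second). [cite: BruhatTits1972, §10] -/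
theorem pairing_glued_eq (σ : K →+* K) (H Y : Matrix (Fin N) (Fin N) K) (b x₀ : Fin N → K) (t : K) :
    pairing σ H (b + t • x₀) (Y *ᵥ (b + t • x₀)) =
      pairing σ H b (Y *ᵥ b) + t * pairing σ H b (Y *ᵥ x₀) + σ t * pairing σ H x₀ (Y *ᵥ b) + σ t * t * pairing σ H x₀ (Y *ᵥ x₀) := by
  simp only [Matrix.mulVec_add, Matrix.mulVec_smul, map_add, LinearMap.map_smulₛₗ₂, map_smul, LinearMap.add_apply, smul_eq_mul]
  ring

omit [Valued K ℤᵐ⁰] in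
/-- `⟨ϖ⁻¹x, Y·ϖ⁻¹x⟩ = −ϖ^{−2}·⟨x, Yx⟩` when `σϖ = −ϖ` (`σ(ϖ⁻¹)ϖ⁻¹ = −ϖ^{−2}`). [cite: BruhatTits1972, §10] -/
theorem pairing_smul_inv_self {σ : K →+* K} {ϖ : K} (hσϖ : σ ϖ = -ϖ) (hϖ0 : ϖ ≠ 0) (H Y : Matrix (Fin N) (Fin N) K) (x : Fin N → K) :
    pairing σ H (ϖ⁻¹ • x) (Y *ᵥ (ϖ⁻¹ • x)) = -(ϖ ^ 2)⁻¹ * pairing σ H x (Y *ᵥ x) := by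
  simp only [Matrix.mulVec_smul, LinearMap.map_smulₛₗ₂, map_smul, smul_eq_mul, map_inv₀, hσϖ]
  field_simp

/-- **THE VALUE LAW ON A GLUED VECTOR.**  Let the form of `H` be integral on `M` (`M ≤ M^♯`), `Y` of level `ϖ^d` on `M` (`ϖ^{−d}·Yz ∈ M` for `z ∈ M`), `σϖ = −ϖ` with `σ`
valuation-preserving, `b, x ∈ M`, `|t| ≤ 1`.  Then for `y = b + t·ϖ⁻¹x`:  **`|ϖ^{−(d−2)}⟨y, Yy⟩ + σ(t)t·ϖ^{−d}⟨x, Yx⟩| ≤ |ϖ|`** (`d ≥ 2`) — the child's depth-`(d−2)` value is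
minus the parent's depth-`d` value at the line, scaled by the norm of the gluing coordinate. [cite: Kottwitz1986, §3] [cite: BruhatTits1972, §10] [cite: Rogawski1990, §4.9 pp. 54–56] -/
theorem v_pairing_glued_mulVec_add_le {σ : K →+* K} (hvσ : ∀ a, Valued.v (σ a) = Valued.v a) {ϖ : K} (hσϖ : σ ϖ = -ϖ) (hϖ1 : Valued.v ϖ ≤ 1) (hϖ0 : ϖ ≠ 0)
    (H : Matrix (Fin N) (Fin N) K) {M : Submodule 𝒪[K] (Fin N → K)} (hMd : M ≤ dualLatt σ H M)
    (Y : Matrix (Fin N) (Fin N) K) {d : ℕ} (hd : 2 ≤ d) (hY : ∀ z ∈ M, (ϖ ^ d)⁻¹ • (Y *ᵥ z) ∈ M)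
    {b x : Fin N → K} (hb : b ∈ M) (hx : x ∈ M) {t : K} (ht : Valued.v t ≤ 1) :
    Valued.v ((ϖ ^ (d - 2))⁻¹ * pairing σ H (b + t • (ϖ⁻¹ • x)) (Y *ᵥ (b + t • (ϖ⁻¹ • x))) + σ t * t * ((ϖ ^ d)⁻¹ * pairing σ H x (Y *ᵥ x))) ≤
      Valued.v ϖ := by
  have hvϖ0 : Valued.v ϖ ≠ 0 := (Valuation.ne_zero_iff _).2 hϖ0
  have hϖd0 : ϖ ^ d ≠ 0 := pow_ne_zero _ hϖ0
  -- integrality of the three small pairings: `ϖ^{-d}⟨z, Yz'⟩ ∈ 𝒪` for `z, z' ∈ M`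
  have hint : ∀ z ∈ M, ∀ z' ∈ M, Valued.v ((ϖ ^ d)⁻¹ * pairing σ H z (Y *ᵥ z')) ≤ 1 := by
    intro z hz z' hz'
    have h := (mem_dualLatt σ H M _).1 (hMd (hY z' hz')) z hz
    rwa [map_smul, smul_eq_mul] at h
  -- rewrite the glued value
  have hx₀ : pairing σ H (ϖ⁻¹ • x) (Y *ᵥ (ϖ⁻¹ • x)) = -(ϖ ^ 2)⁻¹ * pairing σ H x (Y *ᵥ x) := pairing_smul_inv_self hσϖ hϖ0 H Y x
  have hbx : pairing σ H b (Y *ᵥ (ϖ⁻¹ • x)) = ϖ⁻¹ * pairing σ H b (Y *ᵥ x) := by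
    rw [Matrix.mulVec_smul, map_smul, smul_eq_mul]
  have hxb : pairing σ H (ϖ⁻¹ • x) (Y *ᵥ b) = σ ϖ⁻¹ * pairing σ H x (Y *ᵥ b) := by
    simp only [LinearMap.map_smulₛₗ₂, smul_eq_mul]
  have hd2 : (ϖ ^ (d - 2))⁻¹ = (ϖ ^ d)⁻¹ * ϖ ^ 2 := by
    have e : ϖ ^ d = ϖ ^ (d - 2) * ϖ ^ 2 := by rw [← pow_add]; congr 1; omega
    rw [e, mul_inv, mul_assoc, inv_mul_cancel₀ (pow_ne_zero _ hϖ0), mul_one]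
  have hkey : (ϖ ^ (d - 2))⁻¹ * pairing σ H (b + t • (ϖ⁻¹ • x)) (Y *ᵥ (b + t • (ϖ⁻¹ • x))) + σ t * t * ((ϖ ^ d)⁻¹ * pairing σ H x (Y *ᵥ x)) =
      ϖ * (ϖ * ((ϖ ^ d)⁻¹ * pairing σ H b (Y *ᵥ b)) + t * ((ϖ ^ d)⁻¹ * pairing σ H b (Y *ᵥ x)) + (σ ϖ⁻¹ * ϖ) * σ t * ((ϖ ^ d)⁻¹ * pairing σ H x (Y *ᵥ b))) := by
    rw [pairing_glued_eq, hx₀, hbx, hxb, hd2]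
    field_simp
    ring
  rw [hkey, map_mul]
  refine mul_le_of_le_one_right' ?_
  have hσϖi : Valued.v (σ ϖ⁻¹ * ϖ) = 1 := by
    rw [map_mul, hvσ, map_inv₀, inv_mul_cancel₀ hvϖ0]
  refine (Valuation.map_add _ _ _).trans (max_le ((Valuation.map_add _ _ _).trans (max_le ?_ ?_)) ?_)
  · rw [map_mul]; exact mul_le_one' hϖ1 (hint b hb b hb)
  · rw [map_mul]; exact mul_le_one' ht (hint b hb x hx)
  · rw [map_mul, map_mul, hσϖi, one_mul, hvσ]; exact mul_le_one' ht (hint x hx b hb)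

/-! ## §2 The child's form is rank one in the gluing coordinate: one class, the other excluded -/

/-- **RANK ONE IN THE GLUING COORDINATE**: with `σ` moreover residually trivial (`σ(t)t ≡ t²`) and `|ϖ| < 1`:  **`|ϖ^{−(d−2)}⟨y, Yy⟩ + t²·ϖ^{−d}⟨x, Yx⟩| < 1`** for every
`y = b + t·ϖ⁻¹x`, `b ∈ M`, `|t| ≤ 1` — to first order the depth-`(d−2)` form on the glued lattice is `−(ϖ^{−d}⟨x, Yx⟩)·t²`: the square class of the child is the class of MINUS the
parent's value at the line, for every gluing digit. [cite: Kottwitz1986, §3] [cite: Rogawski1990, §4.9 pp. 54–56] -/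
theorem v_pairing_glued_mulVec_add_sq_mul_lt {σ : K →+* K} (hvσ : ∀ a, Valued.v (σ a) = Valued.v a) (hres : ∀ z : K, Valued.v z ≤ 1 → Valued.v (σ z - z) < 1)
    {ϖ : K} (hσϖ : σ ϖ = -ϖ) (hϖ : Valued.v ϖ < 1) (hϖ0 : ϖ ≠ 0)
    (H : Matrix (Fin N) (Fin N) K) {M : Submodule 𝒪[K] (Fin N → K)} (hMd : M ≤ dualLatt σ H M)
    (Y : Matrix (Fin N) (Fin N) K) {d : ℕ} (hd : 2 ≤ d) (hY : ∀ z ∈ M, (ϖ ^ d)⁻¹ • (Y *ᵥ z) ∈ M)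
    {b x : Fin N → K} (hb : b ∈ M) (hx : x ∈ M) {t : K} (ht : Valued.v t ≤ 1) :
    Valued.v ((ϖ ^ (d - 2))⁻¹ * pairing σ H (b + t • (ϖ⁻¹ • x)) (Y *ᵥ (b + t • (ϖ⁻¹ • x))) + t ^ 2 * ((ϖ ^ d)⁻¹ * pairing σ H x (Y *ᵥ x))) < 1 := by
  have h1 := v_pairing_glued_mulVec_add_le hvσ hσϖ hϖ.le hϖ0 H hMd Y hd hY hb hx ht
  have hQ : Valued.v ((ϖ ^ d)⁻¹ * pairing σ H x (Y *ᵥ x)) ≤ 1 := by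
    have h := (mem_dualLatt σ H M _).1 (hMd (hY x hx)) x hx
    rwa [map_smul, smul_eq_mul] at h
  -- the norm correction `(t² − σ(t)t)·Q = −t·(σt − t)·Q ∈ 𝔪`
  have h2 : Valued.v ((t ^ 2 - σ t * t) * ((ϖ ^ d)⁻¹ * pairing σ H x (Y *ᵥ x))) < 1 := by
    have e : (t ^ 2 - σ t * t) = -(t * (σ t - t)) := by ring
    rw [e, map_mul, Valuation.map_neg, map_mul]
    exact mul_lt_one_of_lt_of_le ((mul_le_of_le_one_left' ht).trans_lt (hres t ht)) hQ
  have e : (ϖ ^ (d - 2))⁻¹ * pairing σ H (b + t • (ϖ⁻¹ • x)) (Y *ᵥ (b + t • (ϖ⁻¹ • x))) + t ^ 2 * ((ϖ ^ d)⁻¹ * pairing σ H x (Y *ᵥ x)) =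
      ((ϖ ^ (d - 2))⁻¹ * pairing σ H (b + t • (ϖ⁻¹ • x)) (Y *ᵥ (b + t • (ϖ⁻¹ • x))) + σ t * t * ((ϖ ^ d)⁻¹ * pairing σ H x (Y *ᵥ x))) +
        (t ^ 2 - σ t * t) * ((ϖ ^ d)⁻¹ * pairing σ H x (Y *ᵥ x)) := by ring
  rw [e]
  exact Valuation.map_add_lt _ (h1.trans_lt hϖ) h2

/-- **CLS SHAPE AT A UNIT DIGIT**: under the same hypotheses with `|t| = 1`: `∃ a, |a| = 1 ∧ |ϖ^{−(d−2)}⟨y, Yy⟩ − (−ϖ^{−d}⟨x, Yx⟩)·a²| < 1` (`a = t`) — the glued generator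
realises the class of minus the parent value. [cite: Kottwitz1986, §3] [cite: Rogawski1990, §4.9 pp. 54–56] -/
theorem v_pairing_glued_mulVec_sub_mul_sq_lt_of_unit {σ : K →+* K} (hvσ : ∀ a, Valued.v (σ a) = Valued.v a) (hres : ∀ z : K, Valued.v z ≤ 1 → Valued.v (σ z - z) < 1)
    {ϖ : K} (hσϖ : σ ϖ = -ϖ) (hϖ : Valued.v ϖ < 1) (hϖ0 : ϖ ≠ 0)
    (H : Matrix (Fin N) (Fin N) K) {M : Submodule 𝒪[K] (Fin N → K)} (hMd : M ≤ dualLatt σ H M)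
    (Y : Matrix (Fin N) (Fin N) K) {d : ℕ} (hd : 2 ≤ d) (hY : ∀ z ∈ M, (ϖ ^ d)⁻¹ • (Y *ᵥ z) ∈ M)
    {b x : Fin N → K} (hb : b ∈ M) (hx : x ∈ M) {t : K} (ht : Valued.v t = 1) :
    ∃ a : K, Valued.v a = 1 ∧
      Valued.v ((ϖ ^ (d - 2))⁻¹ * pairing σ H (b + t • (ϖ⁻¹ • x)) (Y *ᵥ (b + t • (ϖ⁻¹ • x))) - (-((ϖ ^ d)⁻¹ * pairing σ H x (Y *ᵥ x))) * a ^ 2) < 1 := by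
  refine ⟨t, ht, ?_⟩
  have h := v_pairing_glued_mulVec_add_sq_mul_lt hvσ hres hσϖ hϖ hϖ0 H hMd Y hd hY hb hx ht.le
  convert h using 2
  ring

/-- **A NON-UNIT DIGIT GIVES A VALUE IN `𝔪`**: under the same hypotheses with `|t| < 1`: `|ϖ^{−(d−2)}⟨y, Yy⟩| < 1`. [cite: Kottwitz1986, §3] -/
theorem v_pairing_glued_mulVec_lt_one_of_lt {σ : K →+* K} (hvσ : ∀ a, Valued.v (σ a) = Valued.v a) (hres : ∀ z : K, Valued.v z ≤ 1 → Valued.v (σ z - z) < 1)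
    {ϖ : K} (hσϖ : σ ϖ = -ϖ) (hϖ : Valued.v ϖ < 1) (hϖ0 : ϖ ≠ 0)
    (H : Matrix (Fin N) (Fin N) K) {M : Submodule 𝒪[K] (Fin N → K)} (hMd : M ≤ dualLatt σ H M)
    (Y : Matrix (Fin N) (Fin N) K) {d : ℕ} (hd : 2 ≤ d) (hY : ∀ z ∈ M, (ϖ ^ d)⁻¹ • (Y *ᵥ z) ∈ M)
    {b x : Fin N → K} (hb : b ∈ M) (hx : x ∈ M) {t : K} (ht : Valued.v t < 1) :
    Valued.v ((ϖ ^ (d - 2))⁻¹ * pairing σ H (b + t • (ϖ⁻¹ • x)) (Y *ᵥ (b + t • (ϖ⁻¹ • x)))) < 1 := by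
  have h := v_pairing_glued_mulVec_add_sq_mul_lt hvσ hres hσϖ hϖ hϖ0 H hMd Y hd hY hb hx ht.le
  have hQ : Valued.v ((ϖ ^ d)⁻¹ * pairing σ H x (Y *ᵥ x)) ≤ 1 := by
    have h' := (mem_dualLatt σ H M _).1 (hMd (hY x hx)) x hx
    rwa [map_smul, smul_eq_mul] at h'
  have hsq : Valued.v (t ^ 2 * ((ϖ ^ d)⁻¹ * pairing σ H x (Y *ᵥ x))) < 1 := by
    rw [map_mul, map_pow]
    have ht2 : Valued.v t ^ 2 < 1 := by
      rw [pow_two]; exact (mul_le_of_le_one_left' ht.le).trans_lt ht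
    exact mul_lt_one_of_lt_of_le ht2 hQ
  have e : (ϖ ^ (d - 2))⁻¹ * pairing σ H (b + t • (ϖ⁻¹ • x)) (Y *ᵥ (b + t • (ϖ⁻¹ • x))) =
      ((ϖ ^ (d - 2))⁻¹ * pairing σ H (b + t • (ϖ⁻¹ • x)) (Y *ᵥ (b + t • (ϖ⁻¹ • x))) + t ^ 2 * ((ϖ ^ d)⁻¹ * pairing σ H x (Y *ᵥ x))) -
        t ^ 2 * ((ϖ ^ d)⁻¹ * pairing σ H x (Y *ᵥ x)) := by ring
  rw [e]
  exact Valuation.map_sub_lt _ h hsq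

/-- **THE OTHER CLASS IS EXCLUDED ON THE WHOLE GLUED LATTICE.**  If the parent value `w := −ϖ^{−d}⟨x, Yx⟩` is a UNIT and `ε` is a residue non-square, then NO vector
`y = b + t·ϖ⁻¹x` (`b ∈ M`, `|t| ≤ 1`) has its depth-`(d−2)` value in the class of `w·ε`: `¬ ∃ a, |a| = 1 ∧ |ϖ^{−(d−2)}⟨y, Yy⟩ − w·ε·a²| < 1` — the child carries ONE class.
[cite: Rogawski1990, §4.9 pp. 54–56] [cite: Kottwitz1986, §3] -/
theorem not_v_pairing_glued_mulVec_sub_mul_mul_sq_lt {σ : K →+* K} (hvσ : ∀ a, Valued.v (σ a) = Valued.v a) (hres : ∀ z : K, Valued.v z ≤ 1 → Valued.v (σ z - z) < 1)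
    {ϖ : K} (hσϖ : σ ϖ = -ϖ) (hϖ : Valued.v ϖ < 1) (hϖ0 : ϖ ≠ 0)
    (H : Matrix (Fin N) (Fin N) K) {M : Submodule 𝒪[K] (Fin N → K)} (hMd : M ≤ dualLatt σ H M)
    (Y : Matrix (Fin N) (Fin N) K) {d : ℕ} (hd : 2 ≤ d) (hY : ∀ z ∈ M, (ϖ ^ d)⁻¹ • (Y *ᵥ z) ∈ M)
    {b x : Fin N → K} (hb : b ∈ M) (hx : x ∈ M) {t : K} (ht : Valued.v t ≤ 1)
    (hunit : Valued.v ((ϖ ^ d)⁻¹ * pairing σ H x (Y *ᵥ x)) = 1) {ε : K} (hε : ∀ z : K, Valued.v z ≤ 1 → Valued.v (z ^ 2 - ε) = 1) :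
    ¬ ∃ a : K, Valued.v a = 1 ∧
      Valued.v ((ϖ ^ (d - 2))⁻¹ * pairing σ H (b + t • (ϖ⁻¹ • x)) (Y *ᵥ (b + t • (ϖ⁻¹ • x))) - (-((ϖ ^ d)⁻¹ * pairing σ H x (Y *ᵥ x))) * ε * a ^ 2) < 1 := by
  rintro ⟨a, ha, hlt⟩
  have hw : Valued.v (-((ϖ ^ d)⁻¹ * pairing σ H x (Y *ᵥ x))) = 1 := by rw [Valuation.map_neg, hunit]
  rcases lt_or_ge (Valued.v t) 1 with htlt | htge
  · -- `|t| < 1`: the value is in `𝔪`, but `w·ε·a²` is a unit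
    have h0 := v_pairing_glued_mulVec_lt_one_of_lt hvσ hres hσϖ hϖ hϖ0 H hMd Y hd hY hb hx htlt
    have hε1 : Valued.v ε = 1 := by simpa using hε 0 (by simp)
    have hu : Valued.v ((-((ϖ ^ d)⁻¹ * pairing σ H x (Y *ᵥ x))) * ε * a ^ 2) = 1 := by
      rw [map_mul, map_mul, map_pow, hw, hε1, ha, one_pow, one_mul, one_mul]
    have := Valuation.map_sub_lt _ h0 hlt
    rw [sub_sub_cancel, hu] at this
    exact lt_irrefl _ this
  · -- `|t| = 1`: the value is in the class of `w`, and the two classes are disjoint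
    have ht1 : Valued.v t = 1 := le_antisymm ht htge
    obtain ⟨a', ha', hlt'⟩ := v_pairing_glued_mulVec_sub_mul_sq_lt_of_unit hvσ hres hσϖ hϖ hϖ0 H hMd Y hd hY hb hx ht1
    exact not_v_sub_mul_sq_lt_and_v_sub_mul_mul_sq_lt hε hw _ ha' ha hlt' hlt

/-! ## §3 ∘ ★ G7: the collar class lock at a split vertex -/

/-- **THE COLLAR CLASS LOCK.**  At a split vertex of ★ G7 (`H` block at `i`, `|H_ii| ≤ 1`, `M ≤ M^♯`, `e_i ∈ M`, `|x_i| ≤ 1` on `M`; `Y` with plane residue `c` and line residue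
`cᵢ` at level `d`, and of level `ϖ^d` on `M`), for every residually isotropic line `x ∈ M` and every glued vector `y = b + t·ϖ⁻¹x` (`b ∈ M`, `|t| ≤ 1`) of the grandchild through
`x̄`:  **`|ϖ^{−(d−2)}⟨y, Yy⟩ − ((c − cᵢ)·H_ii·x_i²)·t²| < 1`** — ALL off-axis grandchildren of the vertex carry the ONE class `(c − cᵢ)H_ii` (times squares), whatever the line and
the gluing digit: `s_b = s₀·κ_b` at the lattice level. [cite: Rogawski1990, §4.9 pp. 54–56] [cite: Kottwitz1986, §3] [cite: BruhatTits1972, §10] -/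
theorem v_pairing_glued_mulVec_sub_mul_sq_lt_of_block {σ : K →+* K} (hvσ : ∀ a, Valued.v (σ a) = Valued.v a) (hres : ∀ z : K, Valued.v z ≤ 1 → Valued.v (σ z - z) < 1)
    {ϖ : K} (hσϖ : σ ϖ = -ϖ) (hϖ : Valued.v ϖ < 1) (hϖ0 : ϖ ≠ 0) {H : Matrix (Fin 3) (Fin 3) K} (i : Fin 3) (hHcol : ∀ l, l ≠ i → H l i = 0)
    (hHii : Valued.v (H i i) ≤ 1) {M : Submodule 𝒪[K] (Fin 3 → K)} (hMd : M ≤ dualLatt σ H M) (he : (Pi.single i (1 : K) : Fin 3 → K) ∈ M)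
    (hcoord : ∀ x ∈ M, Valued.v (x i) ≤ 1) (Y : Matrix (Fin 3) (Fin 3) K) {c cᵢ : K} (hc : Valued.v c ≤ 1) (hcᵢ : Valued.v cᵢ ≤ 1) {d : ℕ} (hd : 2 ≤ d)
    (hYM : ∀ z ∈ M, (ϖ ^ d)⁻¹ • (Y *ᵥ z) ∈ M)
    (hYW : ∀ x ∈ M, x i = 0 → (ϖ ^ (d + 1))⁻¹ • (Y *ᵥ x - (c * ϖ ^ d) • x) ∈ M)
    (hYL : (ϖ ^ (d + 1))⁻¹ • (Y *ᵥ Pi.single i (1 : K) - (cᵢ * ϖ ^ d) • Pi.single i (1 : K)) ∈ M)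
    {x : Fin 3 → K} (hx : x ∈ M) (hiso : Valued.v (pairing σ H x x) < 1) {b : Fin 3 → K} (hb : b ∈ M) {t : K} (ht : Valued.v t ≤ 1) :
    Valued.v ((ϖ ^ (d - 2))⁻¹ * pairing σ H (b + t • (ϖ⁻¹ • x)) (Y *ᵥ (b + t • (ϖ⁻¹ • x))) - (c - cᵢ) * H i i * x i ^ 2 * t ^ 2) < 1 := by
  -- the child value `≡ −t²·Q` and the parent value `Q ≡ (cᵢ − c)H_ii x_i²`
  have hchild := v_pairing_glued_mulVec_add_sq_mul_lt hvσ hres hσϖ hϖ hϖ0 H hMd Y hd hYM hb hx ht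
  have hparent := v_pairing_mulVec_sub_mul_sq_lt_of_block hres hϖ hϖ0 i hHcol hHii hMd he hcoord Y hc hcᵢ d hYW hYL hx hiso
  have ht2 : Valued.v (t ^ 2) ≤ 1 := by rw [map_pow]; exact pow_le_one₀ zero_le ht
  have hcorr : Valued.v (t ^ 2 * ((ϖ ^ d)⁻¹ * pairing σ H x (Y *ᵥ x) - (cᵢ - c) * H i i * x i ^ 2)) < 1 := by
    rw [map_mul]; exact (mul_le_of_le_one_left' ht2).trans_lt hparent
  have e : (ϖ ^ (d - 2))⁻¹ * pairing σ H (b + t • (ϖ⁻¹ • x)) (Y *ᵥ (b + t • (ϖ⁻¹ • x))) - (c - cᵢ) * H i i * x i ^ 2 * t ^ 2 =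
      ((ϖ ^ (d - 2))⁻¹ * pairing σ H (b + t • (ϖ⁻¹ • x)) (Y *ᵥ (b + t • (ϖ⁻¹ • x))) + t ^ 2 * ((ϖ ^ d)⁻¹ * pairing σ H x (Y *ᵥ x))) -
        t ^ 2 * ((ϖ ^ d)⁻¹ * pairing σ H x (Y *ᵥ x) - (cᵢ - c) * H i i * x i ^ 2) := by ring
  rw [e]
  exact Valuation.map_sub_lt _ hchild hcorr

end Literature.NumberTheory.Automorphic.UnitaryLatticeTree

end
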